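import Summits.ValiantsHypothesis.ValiantsHypothesis.Theorems.LacunarySymmetroidMatrixDescartesCensusPivotKit
import Summits.ValiantsHypothesis.ValiantsHypothesis.Theorems.LacunarySymmetroidMatrixDescartesPivotTwoFourWitness
import Summits.ValiantsHypothesis.ValiantsHypothesis.Theorems.LacunarySymmetroidMatrixDescartesWLawBlockSum

/-!
# `MatrixDescartes` census — pivot column: BLOCK SUMS OF PIVOT PENCILS (sizes and indices add, letters fixed);
# every refuted pivot row propagates LINEARLY IN THE SIZE; floors `Z₊ ≥ 3m` at `K = 3` and `Z₊ ≥ 4m` at `K = 4`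

HONEST FRAMING.  Cell `pub-symmetroid`, seat `val-sym-mdr-p2` (gen 7); helper file `--supports` the crux
`Theses.LacunarySymmetroid.MatrixDescartes` (stmt-ValiantsHypothesis-18050, OPEN), NO closure claim.  LOWER-bound /
construction bookkeeping for the typed rows `Pivot.PivotRootLawAt m K q B` of `…CensusPivotDefs` (pivot pencils
`X^e J + ∑ₖ X^{dₖ} Pₖ`, `J` real symmetric of negative index `≤ q` — witnessed by `J + W Wᵀ ⪰ 0` for an `m × q` real `W` —,
`Pₖ ⪰ 0`; by the line `Lift` this is the MDR-universal class).  It proves nothing about the crux (an UPPER bound at fat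
formats), `stub_twoSided`, `DoorA26` / `DoorA34`, the census registers, or `VP ≠ VNP`.

THE LEMMA (`Pivot.BlockSum.superadditive`).  Fix a support `(e; d : Fin K → ℕ)`.  If an `a × a` pivot pencil with index
witness of width `q` has `≥ A` distinct positive determinant roots and a `b × b` one (same support, width `q'`) has `≥ B`,
then an `(a+b) × (a+b)` pivot pencil on the same support with index witness of width `q + q'` has `≥ A + B`: the
block-diagonal sum (`Matrix.fromBlocks` reindexed by `finSumFinEquiv`) of the first with the RESCALED second — letters
`c^e J'`, `c^{dₖ} P'ₖ`, index witness `√(c^e)·W'` (`index_scale`), block index witness `W ⊕ W'` (`index_blk`: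
`blk[J, J'] + (W ⊕ W')(W ⊕ W')ᵀ = blk[J + WWᵀ, J' + W'W'ᵀ] ⪰ 0`), determinant = product (`det_pencil_blk`), and `c > 0`
chosen outside the finite set of root ratios so that the positive root sets are disjoint (tree
`WLawBlockSum.exists_scale_disjoint` / `card_posRoots_mul_of_disjoint` / `card_posRoots_of_eval_comp_mul`).  A witness whose
determinant vanishes identically certifies only `0` and is replaced by `(J, P, W) = (1, 0, 0)` (`det = X^{e·n}`).
Self-sums (`patt_mul`): ONE witness with `A` roots at size `m`, width `q` gives `j·A` roots at size `j·m`, width `j·q`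
for every `j` — here the common-support issue of `…WLawBlockSum` does not arise.

CONSEQUENCES.  `not_pivotRootLawAt_mul : ¬ PivotRootLawAt m K q B → 1 ≤ j → ¬ PivotRootLawAt (j·m) K (j·q) (j·(B+1) − 1)`
(EVERY refuted pivot row propagates linearly in the size; applies verbatim to the staircase rows `…PivotStaircaseK5/K6`
and to any future witness).  From the tree rows `not_pivotRootLawAt_two_three_one_five` (the six-root W-witness, index 1)
and `not_pivotRootLawAt_two_four_one_seven` (val-sym-mdr-p1 g5's eight-root `K = 4` witness, index 1):
`not_pivotRootLawAt_twoMul_three : ¬ PivotRootLawAt (2j) 3 j (6j − 1)` and `not_pivotRootLawAt_twoMul_four :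
¬ PivotRootLawAt (2j) 4 j (8j − 1)` for all `j ≥ 1`; in size currency (`m ≥ 2` even):
`not_pivotRootLawAt_three_of_even : ¬ PivotRootLawAt m 3 (m/2) (3m − 1)` and `not_pivotRootLawAt_four_of_even :
¬ PivotRootLawAt m 4 (m/2) (4m − 1)` — **at ALL even sizes the pivot count reaches `3m` with three PSD letters and `4m`
with four (index `m/2`)**, the all-sizes floors under val-sym-mdr-p1's seat conjecture «`2K` at `m = 2`» (kernel
`K ≤ 3`; `8 ≤ · ≤ 10` at `K = 4`).  These floors are linear in `m` at fixed `K`; the quadratic-in-`m` graft floors of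
`…GraftLaw*` concern GENERAL symmetric pencils (all letters free), not the pivot class.

[folklore] Elementary; Mathlib block matrices + the tree's `Pivot.eval_det_pivot`, `posSemidef_fromBlocks_zero`,
`WLawBlockSum.*`.  Axioms `propext`, `Classical.choice`, `Quot.sound`.
-/

-- `Summit.ValiantsHypothesis.ValiantsHypothesis.…` repeats a component by the single-conjunct
-- summit layout, which the `dupNamespace` linter flags; the name is mandated.
set_option linter.dupNamespace false

namespace Summit.ValiantsHypothesis.ValiantsHypothesis.Theorems.LacunarySymmetroidMatrixDescartes.Pivot

open scoped BigOperators Matrix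
open Polynomial

namespace BlockSum

/-- The block-diagonal sum of two letters, reindexed to `Fin (a + b)`. -/
local notation3 (prettyPrint := false) "blk[" A ", " B "]" =>
  Matrix.reindex finSumFinEquiv finSumFinEquiv (Matrix.fromBlocks A 0 0 B)

/-! ## Scaling the letters of a pivot pencil rescales the variable -/

/-- `det (x^e (c^e J) + ∑ x^{dₖ} (c^{dₖ} Pₖ)) = det ((cx)^e J + ∑ (cx)^{dₖ} Pₖ)`. [folklore] -/
theorem eval_det_pivot_scale {m K : ℕ} (e : ℕ) (d : Fin K → ℕ) (J : Matrix (Fin m) (Fin m) ℝ)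
    (P : Fin K → Matrix (Fin m) (Fin m) ℝ) (c x : ℝ) :
    (Matrix.det (((X : ℝ[X]) ^ e) • (c ^ e • J).map Polynomial.C
        + ∑ k, ((X : ℝ[X]) ^ d k) • (c ^ d k • P k).map Polynomial.C)).eval x
      = (Matrix.det (((X : ℝ[X]) ^ e) • J.map Polynomial.C
        + ∑ k, ((X : ℝ[X]) ^ d k) • (P k).map Polynomial.C)).eval (c * x) := by
  rw [eval_det_pivot, eval_det_pivot]
  congr 1
  rw [mul_pow, smul_smul, mul_comm (x ^ e)]
  congr 1
  refine Finset.sum_congr rfl fun k _ => ?_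
  rw [mul_pow, smul_smul, mul_comm (x ^ d k)]

/-- Rescaled letters have the same number of positive determinant roots (`c > 0`). [folklore] -/
theorem pivotPosRoots_scale {m K : ℕ} (e : ℕ) (d : Fin K → ℕ) (J : Matrix (Fin m) (Fin m) ℝ)
    (P : Fin K → Matrix (Fin m) (Fin m) ℝ) {c : ℝ} (hc : 0 < c) :
    pivotPosRoots e d (c ^ e • J) (fun k => c ^ d k • P k) = pivotPosRoots e d J P := by
  unfold pivotPosRoots
  exact WLawBlockSum.card_posRoots_of_eval_comp_mul _ _ hc (eval_det_pivot_scale e d J P c)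

/-- The index witness survives scaling: `J + W Wᵀ ⪰ 0 ⇒ c^e J + W' W'ᵀ ⪰ 0` with `W' = √(c^e) • W` (`c ≥ 0`). [folklore] -/
theorem index_scale {m q : ℕ} {J : Matrix (Fin m) (Fin m) ℝ} {W : Matrix (Fin m) (Fin q) ℝ}
    (h : (J + W * Wᵀ).PosSemidef) {c : ℝ} (hc : 0 ≤ c) (e : ℕ) :
    (c ^ e • J + (Real.sqrt (c ^ e) • W) * (Real.sqrt (c ^ e) • W)ᵀ).PosSemidef := by
  have hce : 0 ≤ c ^ e := pow_nonneg hc e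
  have hW : (Real.sqrt (c ^ e) • W) * (Real.sqrt (c ^ e) • W)ᵀ = c ^ e • (W * Wᵀ) := by
    rw [Matrix.transpose_smul, Matrix.smul_mul, Matrix.mul_smul, smul_smul, Real.mul_self_sqrt hce]
  rw [hW, ← smul_add]
  exact h.smul hce

/-! ## Block sums of pivot pencils -/

/-- The pivot pencil of block letters is the block-diagonal matrix of the two pivot pencils (entrywise). [folklore] -/
theorem pencil_blk {a b K : ℕ} (e : ℕ) (d : Fin K → ℕ) (J : Matrix (Fin a) (Fin a) ℝ)
    (P : Fin K → Matrix (Fin a) (Fin a) ℝ) (J' : Matrix (Fin b) (Fin b) ℝ) (P' : Fin K → Matrix (Fin b) (Fin b) ℝ) :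
    ((X : ℝ[X]) ^ e) • (blk[J, J']).map Polynomial.C + ∑ k, ((X : ℝ[X]) ^ d k) • (blk[P k, P' k]).map Polynomial.C
      = Matrix.reindex finSumFinEquiv finSumFinEquiv (Matrix.fromBlocks
          (((X : ℝ[X]) ^ e) • J.map Polynomial.C + ∑ k, ((X : ℝ[X]) ^ d k) • (P k).map Polynomial.C) 0 0
          (((X : ℝ[X]) ^ e) • J'.map Polynomial.C + ∑ k, ((X : ℝ[X]) ^ d k) • (P' k).map Polynomial.C)) := by
  refine Matrix.ext fun i j => ?_
  obtain ⟨i, rfl⟩ := finSumFinEquiv.surjective i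
  obtain ⟨j, rfl⟩ := finSumFinEquiv.surjective j
  simp only [Matrix.reindex_apply, Matrix.submatrix_apply, Equiv.symm_apply_apply, Matrix.add_apply,
    Matrix.smul_apply, Matrix.map_apply, Matrix.sum_apply]
  rcases i with i | i <;> rcases j with j | j <;> simp [Matrix.fromBlocks, Matrix.sum_apply]

/-- Hence the positive-root sets multiply: the block determinant is the product of the two determinants. [folklore] -/
theorem det_pencil_blk {a b K : ℕ} (e : ℕ) (d : Fin K → ℕ) (J : Matrix (Fin a) (Fin a) ℝ)
    (P : Fin K → Matrix (Fin a) (Fin a) ℝ) (J' : Matrix (Fin b) (Fin b) ℝ) (P' : Fin K → Matrix (Fin b) (Fin b) ℝ) :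
    Matrix.det (((X : ℝ[X]) ^ e) • (blk[J, J']).map Polynomial.C
        + ∑ k, ((X : ℝ[X]) ^ d k) • (blk[P k, P' k]).map Polynomial.C)
      = Matrix.det (((X : ℝ[X]) ^ e) • J.map Polynomial.C + ∑ k, ((X : ℝ[X]) ^ d k) • (P k).map Polynomial.C)
        * Matrix.det (((X : ℝ[X]) ^ e) • J'.map Polynomial.C + ∑ k, ((X : ℝ[X]) ^ d k) • (P' k).map Polynomial.C) := by
  rw [pencil_blk, Matrix.det_reindex_self, Matrix.det_fromBlocks_zero₂₁]

/-- **Indices add under block sums**: with the block index witness `W ⊕ W'` (an `(a+b) × (q+q')` matrix),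
`blk[J, J'] + (W ⊕ W')(W ⊕ W')ᵀ = blk[J + W Wᵀ, J' + W' W'ᵀ] ⪰ 0`. [folklore] -/
theorem index_blk {a b q q' : ℕ} {J : Matrix (Fin a) (Fin a) ℝ} {W : Matrix (Fin a) (Fin q) ℝ}
    {J' : Matrix (Fin b) (Fin b) ℝ} {W' : Matrix (Fin b) (Fin q') ℝ}
    (h : (J + W * Wᵀ).PosSemidef) (h' : (J' + W' * W'ᵀ).PosSemidef) :
    (blk[J, J'] + Matrix.reindex finSumFinEquiv finSumFinEquiv (Matrix.fromBlocks W 0 0 W')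
        * (Matrix.reindex finSumFinEquiv finSumFinEquiv (Matrix.fromBlocks W 0 0 W'))ᵀ).PosSemidef := by
  have hmul : Matrix.reindex finSumFinEquiv finSumFinEquiv (Matrix.fromBlocks W 0 0 W')
        * (Matrix.reindex finSumFinEquiv finSumFinEquiv (Matrix.fromBlocks W 0 0 W'))ᵀ
      = Matrix.reindex finSumFinEquiv finSumFinEquiv (Matrix.fromBlocks (W * Wᵀ) 0 0 (W' * W'ᵀ)) := by
    rw [Matrix.reindex_apply, Matrix.reindex_apply, Matrix.transpose_submatrix, Matrix.submatrix_mul_equiv,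
      Matrix.fromBlocks_transpose, Matrix.fromBlocks_multiply]
    simp
  have hsum : blk[J, J'] + Matrix.reindex finSumFinEquiv finSumFinEquiv (Matrix.fromBlocks (W * Wᵀ) 0 0 (W' * W'ᵀ))
      = blk[J + W * Wᵀ, J' + W' * W'ᵀ] := by
    rw [Matrix.reindex_apply, Matrix.reindex_apply, Matrix.reindex_apply]
    change (Matrix.fromBlocks J 0 0 J' + Matrix.fromBlocks (W * Wᵀ) 0 0 (W' * W'ᵀ)).submatrix _ _ = _
    simp only [Matrix.fromBlocks_add, add_zero]
  rw [hmul, hsum, Matrix.reindex_apply]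
  exact (posSemidef_fromBlocks_zero h h').submatrix _

/-! ## Superadditivity of attainable pivot counts (fixed support, sizes and indices add) -/

/-- «some `n × n` pivot pencil on the support `(e; d)` with index witness of width `q` has `≥ A` positive roots» -/
local notation3 (prettyPrint := false) "PAtt[" e ", " d ", " n ", " q ", " A "]" =>
  ∃ (J : Matrix (Fin n) (Fin n) ℝ) (P : Fin _ → Matrix (Fin n) (Fin n) ℝ) (W : Matrix (Fin n) (Fin q) ℝ),
    J.IsSymm ∧ (∀ k, (P k).PosSemidef) ∧ (J + W * Wᵀ).PosSemidef ∧ A ≤ pivotPosRoots e d J P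

/-- A pivot row FAILS exactly when some pencil beats the budget. [bookkeeping] -/
theorem not_pivotRootLawAt_iff {m K q B : ℕ} :
    ¬ PivotRootLawAt m K q B ↔ ∃ (e : ℕ) (d : Fin K → ℕ), PAtt[e, d, m, q, B + 1] := by
  constructor
  · intro h
    unfold PivotRootLawAt at h
    simp only [not_forall, not_le, exists_prop] at h
    obtain ⟨e, d, J, P, hJ, hP, ⟨W, hW⟩, hlt⟩ := h
    exact ⟨e, d, J, P, W, hJ, hP, hW, hlt⟩
  · rintro ⟨e, d, J, P, W, hJ, hP, hW, hA⟩ h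
    exact absurd (h e d J P hJ hP ⟨W, hW⟩) (by omega)

/-- From an attainability witness extract one whose determinant is a NONZERO polynomial (a vanishing determinant
certifies only `0`; then use `J = 1`, `P = 0`, `W = 0`: `det = X^{e·n} ≠ 0`). [folklore] -/
theorem exists_witness_det_ne_zero {n K q A : ℕ} (e : ℕ) (d : Fin K → ℕ) (h : PAtt[e, d, n, q, A]) :
    ∃ (J : Matrix (Fin n) (Fin n) ℝ) (P : Fin K → Matrix (Fin n) (Fin n) ℝ) (W : Matrix (Fin n) (Fin q) ℝ),
      J.IsSymm ∧ (∀ k, (P k).PosSemidef) ∧ (J + W * Wᵀ).PosSemidef ∧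
      Matrix.det (((X : ℝ[X]) ^ e) • J.map Polynomial.C + ∑ k, ((X : ℝ[X]) ^ d k) • (P k).map Polynomial.C) ≠ 0 ∧
      A ≤ pivotPosRoots e d J P := by
  obtain ⟨J, P, W, hJ, hP, hW, hA⟩ := h
  by_cases hdet : Matrix.det (((X : ℝ[X]) ^ e) • J.map Polynomial.C
      + ∑ k, ((X : ℝ[X]) ^ d k) • (P k).map Polynomial.C) = 0
  · have hA0 : A = 0 := by
      unfold pivotPosRoots at hA
      rw [hdet, Polynomial.roots_zero, Multiset.toFinset_zero, Finset.filter_empty, Finset.card_empty,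
        Nat.le_zero] at hA
      exact hA
    subst hA0
    refine ⟨1, fun _ => 0, 0, Matrix.isSymm_one, fun _ => Matrix.PosSemidef.zero, ?_, ?_, Nat.zero_le _⟩
    · simpa using Matrix.PosSemidef.one
    · have h1 : ((X : ℝ[X]) ^ e) • (1 : Matrix (Fin n) (Fin n) ℝ).map Polynomial.C
          + ∑ k, ((X : ℝ[X]) ^ d k) • (0 : Matrix (Fin n) (Fin n) ℝ).map Polynomial.C
          = ((X : ℝ[X]) ^ e) • (1 : Matrix (Fin n) (Fin n) ℝ[X]) := by
        simp [Matrix.map_zero _ Polynomial.C_0]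
      rw [h1, Matrix.det_smul, Matrix.det_one, mul_one, Fintype.card_fin]
      exact pow_ne_zero _ (pow_ne_zero _ Polynomial.X_ne_zero)
  · exact ⟨J, P, W, hJ, hP, hW, hdet, hA⟩

/-- **SUPERADDITIVITY OF ATTAINABLE PIVOT COUNTS** (fixed support `(e; d)`, fixed number of letters `K`): sizes AND
index widths add, counts add.  Block-diagonal sum of the first pencil with a generic rescaling `x ↦ c·x` of the second
(letters `c^e J'`, `c^{dₖ} P'ₖ`, index witness `√(c^e)·W'`), `c > 0` outside the finitely many root ratios. [folklore] -/
theorem superadditive {a b K q q' A B : ℕ} (e : ℕ) (d : Fin K → ℕ)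
    (ha : PAtt[e, d, a, q, A]) (hb : PAtt[e, d, b, q', B]) : PAtt[e, d, a + b, q + q', A + B] := by
  obtain ⟨J, P, W, hJ, hP, hW, hpne, hA⟩ := exists_witness_det_ne_zero e d ha
  obtain ⟨J', P', W', hJ', hP', hW', hqne, hB⟩ := exists_witness_det_ne_zero e d hb
  set p := Matrix.det (((X : ℝ[X]) ^ e) • J.map Polynomial.C + ∑ k, ((X : ℝ[X]) ^ d k) • (P k).map Polynomial.C)
    with hp
  set pq := Matrix.det (((X : ℝ[X]) ^ e) • J'.map Polynomial.C + ∑ k, ((X : ℝ[X]) ^ d k) • (P' k).map Polynomial.C)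
    with hpq
  obtain ⟨c, hc, hsep⟩ := WLawBlockSum.exists_scale_disjoint p pq
  -- the rescaled second pencil
  set qc := Matrix.det (((X : ℝ[X]) ^ e) • (c ^ e • J').map Polynomial.C
      + ∑ k, ((X : ℝ[X]) ^ d k) • (c ^ d k • P' k).map Polynomial.C) with hqc
  have hqc_eval : ∀ x, qc.eval x = pq.eval (c * x) := fun x => eval_det_pivot_scale e d J' P' c x
  have hqcne : qc ≠ 0 := by
    intro h0
    apply hqne
    refine Polynomial.funext fun y => ?_
    have := hqc_eval (y / c)
    rw [h0, mul_div_cancel₀ y hc.ne'] at this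
    simpa using this.symm
  have hdis : Disjoint (p.roots.toFinset.filter (fun t => 0 < t)) (qc.roots.toFinset.filter (fun t => 0 < t)) := by
    rw [Finset.disjoint_left]
    intro x hxp hxq
    rw [Finset.mem_filter] at hxp hxq
    refine hsep x hxp.2 hxp.1 ?_
    rw [Multiset.mem_toFinset, Polynomial.mem_roots hqne, Polynomial.IsRoot.def, ← hqc_eval]
    exact (Polynomial.mem_roots hqcne).1 (Multiset.mem_toFinset.1 hxq.1)
  have hB' : B ≤ ((qc.roots.toFinset.filter (fun t => 0 < t))).card := by
    have h := pivotPosRoots_scale e d J' P' hc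
    unfold pivotPosRoots at h hB
    rw [← hqc] at h
    rw [h]
    exact hB
  have hA' : A ≤ ((p.roots.toFinset.filter (fun t => 0 < t))).card := by
    unfold pivotPosRoots at hA
    exact hA
  refine ⟨blk[J, c ^ e • J'], fun k => blk[P k, c ^ d k • P' k],
    Matrix.reindex finSumFinEquiv finSumFinEquiv (Matrix.fromBlocks W 0 0 (Real.sqrt (c ^ e) • W')),
    WLawBlockSum.isSymm_blk hJ (hJ'.smul _), fun k => WLawBlockSum.posSemidef_blk (hP k) ((hP' k).smul (pow_nonneg hc.le _)),
    index_blk hW (index_scale hW' hc.le e), ?_⟩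
  unfold pivotPosRoots
  rw [det_pencil_blk, ← hp, ← hqc, WLawBlockSum.card_posRoots_mul_of_disjoint p qc hpne hqcne hdis]
  exact Nat.add_le_add hA' hB'

/-- Transport of attainability along equalities of size and index width. [bookkeeping] -/
theorem patt_cast {K n n' q q' A : ℕ} (e : ℕ) (d : Fin K → ℕ) (hn : n = n') (hq : q = q')
    (h : PAtt[e, d, n, q, A]) : PAtt[e, d, n', q', A] := by
  subst hn hq
  exact h

/-- **Self-sums**: a witness with `A` roots at size `m`, index width `q` gives, for every `j`, a witness with `j·A` roots at
size `j·m`, index width `j·q` (same support, same number of letters). [folklore] -/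
theorem patt_mul {K m q A : ℕ} (e : ℕ) (d : Fin K → ℕ) (h : PAtt[e, d, m, q, A]) (j : ℕ) :
    PAtt[e, d, j * m, j * q, j * A] := by
  induction j with
  | zero =>
    rw [Nat.zero_mul, Nat.zero_mul, Nat.zero_mul]
    exact ⟨0, fun _ => 0, 0, Matrix.isSymm_zero, fun _ => Matrix.PosSemidef.zero, by simpa using Matrix.PosSemidef.zero,
      Nat.zero_le _⟩
  | succ j ih =>
    have h2 := superadditive e d ih h
    rw [← Nat.succ_mul j A] at h2
    exact patt_cast e d (Nat.succ_mul j m).symm (Nat.succ_mul j q).symm h2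

end BlockSum

open BlockSum in
/-- **EVERY REFUTED PIVOT ROW PROPAGATES LINEARLY IN THE SIZE**: if `PivotRootLawAt m K q B` fails (some `m × m` pivot
pencil with `K` PSD letters and index `≤ q` has `> B` positive roots), then for every `j ≥ 1` the row
`PivotRootLawAt (j·m) K (j·q) (j·(B+1) − 1)` fails too (block sum of `j` rescaled copies: size `j·m`, index `≤ j·q`,
`≥ j·(B+1)` positive roots).  Exact; same support. [folklore] -/
theorem not_pivotRootLawAt_mul {m K q B : ℕ} (h : ¬ PivotRootLawAt m K q B) {j : ℕ} (hj : 1 ≤ j) :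
    ¬ PivotRootLawAt (j * m) K (j * q) (j * (B + 1) - 1) := by
  obtain ⟨e, d, hatt⟩ := not_pivotRootLawAt_iff.1 h
  refine not_pivotRootLawAt_iff.2 ⟨e, d, ?_⟩
  have hmul := patt_mul e d hatt j
  have hj' : j * (B + 1) - 1 + 1 = j * (B + 1) := by
    have : 1 ≤ j * (B + 1) := Nat.le_trans hj (Nat.le_mul_of_pos_right j (Nat.succ_pos B))
    omega
  rw [hj']
  exact hmul

/-- **`K = 3`: `Z₊ ≥ 3m` at every even size** — from the tree's `¬ PivotRootLawAt 2 3 1 5` (the six-root W-witness, index 1):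
for every `j ≥ 1` some `(2j) × (2j)` pivot pencil with three PSD letters and index `≤ j` has `≥ 6j` positive roots. [folklore] -/
theorem not_pivotRootLawAt_twoMul_three {j : ℕ} (hj : 1 ≤ j) : ¬ PivotRootLawAt (j * 2) 3 (j * 1) (j * 6 - 1) :=
  not_pivotRootLawAt_mul not_pivotRootLawAt_two_three_one_five hj

/-- **`K = 4`: `Z₊ ≥ 4m` at every even size** — from the tree's `¬ PivotRootLawAt 2 4 1 7` (mdr-p1 g5's eight-root witness,
index 1): for every `j ≥ 1` some `(2j) × (2j)` pivot pencil with four PSD letters and index `≤ j` has `≥ 8j` positive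
roots. [folklore] -/
theorem not_pivotRootLawAt_twoMul_four {j : ℕ} (hj : 1 ≤ j) : ¬ PivotRootLawAt (j * 2) 4 (j * 1) (j * 8 - 1) :=
  not_pivotRootLawAt_mul not_pivotRootLawAt_two_four_one_seven hj

/-- The `K = 3` floor in size currency: for even `m ≥ 2`, `¬ PivotRootLawAt m 3 (m / 2) (3·m − 1)`. [bookkeeping] -/
theorem not_pivotRootLawAt_three_of_even {m : ℕ} (hm : 2 ≤ m) (heven : Even m) :
    ¬ PivotRootLawAt m 3 (m / 2) (3 * m - 1) := by
  obtain ⟨j, rfl⟩ := heven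
  have hj : 1 ≤ j := by omega
  have h := not_pivotRootLawAt_twoMul_three hj
  have e1 : j * 2 = j + j := by ring
  have e2 : j * 1 = (j + j) / 2 := by omega
  have e3 : j * 6 - 1 = 3 * (j + j) - 1 := by omega
  rw [e1, e2, e3] at h
  exact h

/-- The `K = 4` floor in size currency: for even `m ≥ 2`, `¬ PivotRootLawAt m 4 (m / 2) (4·m − 1)`. [bookkeeping] -/
theorem not_pivotRootLawAt_four_of_even {m : ℕ} (hm : 2 ≤ m) (heven : Even m) :
    ¬ PivotRootLawAt m 4 (m / 2) (4 * m - 1) := by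
  obtain ⟨j, rfl⟩ := heven
  have hj : 1 ≤ j := by omega
  have h := not_pivotRootLawAt_twoMul_four hj
  have e1 : j * 2 = j + j := by ring
  have e2 : j * 1 = (j + j) / 2 := by omega
  have e3 : j * 8 - 1 = 4 * (j + j) - 1 := by omega
  rw [e1, e2, e3] at h
  exact h

end Summit.ValiantsHypothesis.ValiantsHypothesis.Theorems.LacunarySymmetroidMatrixDescartes.Pivot
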